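import Summits.ABC.IUTFork.Joshi.ArchimedeanUntiltsJoshi
import Mathlib.RingTheory.Perfection
import Mathlib.Topology.Algebra.ContinuousMonoidHom

/-!
# Joshi, *Arithmetic Teichmüller Spaces II½* (arXiv:2305.10398v12) §3 «Deformation of a field keeping its multiplicative
# structure fixed» (Def. 3.1.1 `R̃ = lim_{x ↦ x^p} R`, Lem. 3.1.4, §3.2, Thm. 3.2.2, Cor. 3.3.1, Thm. 3.5.1) — TYPED over Mathlib's `Perfection`;
# the elementary parts PROVED, nothing asserted (§5.6, Thm. 5.6.1 / Cor. 5.6.2, is the sequel `Joshi/ArithmeticoidMultiplicative.lean`)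

Record file of the abc-iut cell, branch E «type Joshi's construction, test vs S» (rung LADDER-ABC:A2.E; seat abc-iut-E-t38, second
[J-II½] slot; node ids J2h:Def3.1.1, Lem3.1.4, Prop3.2.1, Thm3.2.2, Cor3.3.1, Thm3.4.1, Rmk3.4.2, Thm3.5.1, Rmk3.5.2, Rmk3.5.3 of
plan/E/JOSHI-DAG.tsv (J2h:Thm5.6.1, Cor5.6.2, Rmk6.1.3/6.2.2/6.2.5 → sequel `Joshi/ArithmeticoidMultiplicative.lean`); inventory plan/E/t38/INVENTORY-2.tsv; companion of
`Joshi/ArchimedeanUntiltsJoshi.lean`). SOURCE: K. Joshi, *Construction of Arithmetic Teichmüller Spaces II½: Deformations of Number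
Fields*, arXiv:2305.10398**v12** («Preliminary version for comments», UNREFEREED; bib `Joshi2023ATS2half`). Locators «p.N l.M» =
line M of page file `pNNNN.txt` of `HOME/plan/repair/lit/renders/Joshi-arxiv-2305.10398-ATS2half/`. **No side is taken** on
[IUTchIII] Cor. 3.12, on Joshi's claims, or on Mochizuki's report on them; typed ≠ proved; print's assertions are
`@[claim "Joshi2023ATS2half" "disputed"] def … : Prop`, never axioms / instances / Literature facts; what FOLLOWS is proved.

CARRIERS AND DICTIONARY. Def. 3.1.1's `R̃ := lim_{x ↦ x^p} R` («collections (x_n) of elements of K such that x^p_{n+1} = x_n», p.17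
l.1–3) IS Mathlib's `Perfection.submonoid M p ⊆ (ℕ → M)` — `tildeMonoid`, `mem_tildeMonoid_iff` by `Iff.rfl` (print indexes by
`n ∈ ℤ`; the `ℤ`-indexed and `ℕ`-indexed limits determine each other, the negative entries being `x_{−k} = x_0^{p^k}`). PROVED
here: the `p`-th power map of `K̃` is an AUTOMORPHISM (its inverse is the shift) — `powEquiv` — which is the map of Cor. 5.6.2;
`lim_{x ↦ x^1} M ≃ M` (`tildeOneEquiv`), so that at an archimedean place (`p_v = 1`, [J-II½] Cor. 5.6.2 p.35 l.53–54, slot T-37's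
`DeformationDatum.p_arch`) the uniform definition gives Joshi's «K̃ = K^*» (§3.1 p.16 l.35–38); the one-units `1 + 𝔪_{𝒪_K}` of a
non-archimedean Bourbaki valued field form a submonoid (`oneUnits`, ultrametric computation) and `𝔪` an additive subgroup.
Valued fields are slot T-37's `ATS2h.IsValuedField` and `IsNonarchimedeanAbs` of the companion file; arithmeticoids, `ϕ_v`, `ϕ`,
`p_v`, `K_{y_v}` are T-37's `ATS2h.DeformationDatum` (IMPORTED, nothing restated). §5.6 (sequel file) is typed on UNITS: `K̃^×_{v,y} :=
lim_{x ↦ x^{p_v}} K^×_{y_v}` (`tildeUnitsAt`) — READING FLAG (E-ref): this is print's `K̃_{v}` minus its absorbing element `0` at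
non-archimedean `v` and exactly print's `K̃ = K^*` at archimedean `v`. Thm. 5.6.1 is DERIVED from per-factor tilt data (`TiltDatum`:
Lem. 3.1.4 ∘ Def. 5.1.1's `K♭_{y_v} ≃ L̂♭_v`, as DATA) exactly as its printed proof («clear from Lemma 3.1.4, Theorem 3.2.2 and
Theorem 5.5.2»); Cor. 5.6.2 needs print's tacit identification of the untilt FIELDS at `y` and `ϕ(y)` (a parameter `ι`) and stays
a claim, its MAP being the proved automorphism `powFamily`. NOT TYPED (RECORD, reasons): Thm. 3.4.1 / Rmk. 3.4.2 (the universal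
`Ĝ_m(𝒪_F)`-monoid formal group law of [Joshi 2019] over `L_{Ĝ_m(𝒪_F)} → W(𝒪_F) = A_inf` — monoid formal group laws have no carrier in
Mathlib or the tree (Mathlib: `WittVector` only), registry `cited_by = 0`, no S-spine consumer); the `ℚ_p`-Banach / `ℤ_p`-module
clauses of Prop. 3.2.1, Thm. 3.2.2 (2), Thm. 3.5.1 and the kernel clause of the logarithm (p.17 l.20–25 «the kernel of this
homomorphism is a one dimensional ℚ_p-vector space») are recorded in docstrings, the typed statements being at the level of
topological monoids / groups; the two quotient descriptions of `|Y_{F,ℚ_p}|` in Thm. 3.5.1 (need the Lubin–Tate `ℤ_p^*`-action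
[FF18, 2.3.11]); Rmk. 3.5.2 / 3.5.3 (p.20 l.1–13: additive vs multiplicative «avatar»; «in [IUTchI–IV] Mochizuki works with Q̄_p
and wants to make a similar assertion–but … it is difficult to exhibit the difference between two versions of Q̄_p» — an E6
attach candidate, quoted, not adjudicated); Rmk. 6.1.3 (p.44 l.11–12 «one may canonically construct Mochizuki's Hodge Theater …
using the datum of any adelic point of 𝔍(X/L)» — [J-III] §10, slots T-34/E-t32), Rmk. 6.2.2 / 6.2.5 (quoted in the docstrings of
`Holomorphoid`, file `Joshi/ArithmeticoidCohomology.lean`). TEST-RELEVANCE NOTE (E-cx; located, not adjudicated): Cor. 5.6.2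
(«ϕ is the p_v-th power operation on the local multiplicative monoids», p.35 l.63–66) is the [J-II½] print home, at the level of a
number field, of the valuation-RESCALING move (`|x̃^{p}| = |x̃|^{p}`) that E-PLAN §2 isolates as load-bearing (cf. [J-III]
Prop. 10.3.3 (2), slot T-34; seat E-t1's `UntiltPoints.IsDilatation`). Standard axioms only; sorry-free.
[claim: Joshi2023ATS2half, status: disputed]
-/

set_option autoImplicit false

noncomputable section

open Set

namespace Summit.ABC.IUTFork.Joshi.ATS2half

open Summit.ABC.IUTFork.Joshi.ATS2h (IsValuedField)

universe u

/-! ## 1. §3.1 Def. 3.1.1: `R̃ = lim_{x ↦ x^p} R` = Mathlib's `Perfection.submonoid`; the `p`-th power map is an automorphism -/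

section Tilde

variable (M : Type u) [CommMonoid M] (p : ℕ)

/-- **Def. 3.1.1 / (3.1.2) / (3.1.3)** (p.16 l.26–34): «Fix a prime p and for any algebra R. I will write R for the multiplicative
monoid of R and define a new multiplicative monoid R̃ defined by R̃ = lim_{← x ↦ x^p} R … the multiplicative monoid K̃ by K̃ =
lim_{← x ↦ x^p} K»; p.17 l.1–3: «Elements of K̃ may be thought of as collections (x_n)_{n∈ℤ} of sequences of elements x_n of K such
that x^p_{n+1} = x_n for all n». This IS Mathlib's monoid perfection `Perfection.submonoid M p` (ℕ-indexed; DICTIONARY row, definitional; Mathlib records the bijectivity of the `p`-th power map on it as `PerfectRing (Perfection M p) p`).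
[claim: Joshi2023ATS2half, status: disputed] -/
abbrev tildeMonoid : Submonoid (ℕ → M) := Perfection.submonoid M p

/-- Membership in `R̃`: the printed condition `x_{n+1}^p = x_n`. [folklore] -/
theorem mem_tildeMonoid_iff (f : ℕ → M) : f ∈ tildeMonoid M p ↔ ∀ n, f (n + 1) ^ p = f n := Iff.rfl

variable {M p}

/-- The `p`-th power of an element of `R̃`, coordinatewise, lies in `R̃`. [folklore] -/
theorem pow_mem_tildeMonoid {f : ℕ → M} (hf : f ∈ tildeMonoid M p) : (fun n => f n ^ p) ∈ tildeMonoid M p :=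
  fun n => by
    show (f (n + 1) ^ p) ^ p = f n ^ p
    rw [hf n]

/-- The shift `(x_n)_n ↦ (x_{n+1})_n` of an element of `R̃` lies in `R̃`. [folklore] -/
theorem shift_mem_tildeMonoid {f : ℕ → M} (hf : f ∈ tildeMonoid M p) : (fun n => f (n + 1)) ∈ tildeMonoid M p :=
  fun n => hf (n + 1)

variable (M p)

/-- **The `p`-th power map `x̃ ↦ x̃^p` is an AUTOMORPHISM of `R̃`** (its inverse is the shift `(x_n) ↦ (x_{n+1})`): the map of
Cor. 5.6.2 («ϕ is the p_v-th power operation on the local multiplicative monoids», p.35 l.63–66), PROVED to be a multiplicative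
bijection on any `lim_{x ↦ x^p} M`. [folklore] -/
def powEquiv : tildeMonoid M p ≃* tildeMonoid M p where
  toFun f := ⟨fun n => f.1 n ^ p, pow_mem_tildeMonoid f.2⟩
  invFun g := ⟨fun n => g.1 (n + 1), shift_mem_tildeMonoid g.2⟩
  left_inv f := Subtype.ext (funext fun n => f.2 n)
  right_inv g := Subtype.ext (funext fun n => g.2 n)
  map_mul' f g := Subtype.ext (funext fun n => mul_pow (f.1 n) (g.1 n) p)

/-- `powEquiv` is coordinatewise `x_n ↦ x_n^p`. [folklore] -/
@[simp] theorem powEquiv_apply_coe (f : tildeMonoid M p) (n : ℕ) : ((powEquiv M p f : tildeMonoid M p) : ℕ → M) n = f.1 n ^ p :=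
  rfl

/-- **`lim_{x ↦ x^1} M ≃ M`**: with exponent `1` the tower is constant, so the perfection is `M` itself — whence, at an archimedean
place (`p_v = 1`), the uniform definition returns Joshi's «for an Archimedean algebraically closed perfectoid field K, define
K̃ = K^*» (§3.1 p.16 l.35–38) when applied to `K^*`. [folklore] -/
def tildeOneEquiv : tildeMonoid M 1 ≃* M where
  toFun f := f.1 0
  invFun m := ⟨fun _ => m, fun _ => pow_one m⟩
  left_inv f := by
    refine Subtype.ext (funext fun n => ?_)
    induction n with
    | zero => rfl
    | succ n ih =>
      have h := f.2 n
      rw [pow_one] at h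
      change f.1 0 = f.1 (n + 1)
      rw [h]; exact ih
  right_inv _ := rfl
  map_mul' _ _ := rfl

variable {M p} {N : Type u} [CommMonoid N]

/-- Functoriality of `R ↦ R̃` in isomorphisms of monoids (used to transport along print's identification of untilt fields in
Cor. 5.6.2). [folklore] -/
def tildeMap (e : M ≃* N) : tildeMonoid M p ≃* tildeMonoid N p where
  toFun f := ⟨fun n => e (f.1 n), fun n => by rw [← map_pow, f.2 n]⟩
  invFun g := ⟨fun n => e.symm (g.1 n), fun n => by rw [← map_pow, g.2 n]⟩
  left_inv f := Subtype.ext (funext fun _ => e.symm_apply_apply _)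
  right_inv g := Subtype.ext (funext fun _ => e.apply_symm_apply _)
  map_mul' f g := Subtype.ext (funext fun _ => map_mul e _ _)

/-- `tildeMap` commutes with the `p`-th power map. [folklore] -/
theorem tildeMap_powEquiv (e : M ≃* N) (f : tildeMonoid M p) :
    tildeMap e (powEquiv M p f) = powEquiv N p (tildeMap e f) :=
  Subtype.ext (funext fun _ => map_pow e _ _)

end Tilde

/-- §3.1 (p.16 l.35–38): «For an Archimedean algebraically closed perfectoid field K, define K̃ = K^* (This is consistent with the
choice of ϕ = 1 in the archimedean case.) Note the asymmetry in the non-archimedean and the archimedean case.»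
[claim: Joshi2023ATS2half, status: disputed] -/
abbrev tildeArch (K : Type u) [Field K] : Type u := Kˣ

/-! ## 2. §3.2: one-units `1 + 𝔪_{𝒪_K}`, their tilde, the logarithm; Lem. 3.1.4, Prop. 3.2.1 (claims) -/

section OneUnits

variable {K : Type u} [Field K] {abs : K → ℝ}

/-- In a non-archimedean Bourbaki valued field, `|−1| = 1`-free form of `|x − 1| = |1 − x|`: `|−x| = |x|`. [folklore] -/
theorem abs_neg_of_valued (hv : IsValuedField abs) (x : K) : abs (-x) = abs x := by
  have h1 : abs (-1 : K) * abs (-1 : K) = 1 := by rw [← hv.map_mul]; simp [hv.map_one]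
  have hnn := hv.nonneg (-1 : K)
  have h : abs (-1 : K) = 1 := by nlinarith [hnn, h1, sq_nonneg (abs (-1 : K) - 1)]
  rw [← neg_one_mul, hv.map_mul, h, one_mul]

/-- **`1 + 𝔪_{𝒪_K}`, the one-units of a non-archimedean valued field** (§3.2 p.17 l.13–16: «the submonoid 1 + 𝔪_{𝒪_K} ⊂ 𝒪_K of
1-units»): `{x : |x − 1| < 1}` IS a submonoid (ultrametric computation, PROVED). [folklore] -/
def oneUnits (hv : IsValuedField abs) (hna : IsNonarchimedeanAbs abs) : Submonoid K where
  carrier := {x | abs (x - 1) < 1}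
  mul_mem' {x y} hx hy := by
    simp only [mem_setOf_eq] at hx hy ⊢
    have hxy : x * y - 1 = (x - 1) * (y - 1) + ((x - 1) + (y - 1)) := by ring
    rw [hxy]
    refine (hna _ _).trans_lt (max_lt ?_ ((hna _ _).trans_lt (max_lt hx hy)))
    rw [hv.map_mul]
    calc abs (x - 1) * abs (y - 1) < 1 * 1 :=
          mul_lt_mul'' hx hy (hv.nonneg _) (hv.nonneg _)
      _ = 1 := one_mul 1
  one_mem' := by
    simp only [mem_setOf_eq, sub_self]
    rw [(hv.eq_zero_iff 0).2 rfl]; exact one_pos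

/-- Membership in `1 + 𝔪`. [folklore] -/
theorem mem_oneUnits_iff (hv : IsValuedField abs) (hna : IsNonarchimedeanAbs abs) (x : K) :
    x ∈ oneUnits hv hna ↔ abs (x - 1) < 1 := Iff.rfl

/-- **`𝔪_{𝒪_K} = {x : |x| < 1}` is an additive subgroup** in a non-archimedean valued field (PROVED; the additive side of Thm. 3.5.1).
[folklore] -/
def maxIdeal (hv : IsValuedField abs) (hna : IsNonarchimedeanAbs abs) : AddSubgroup K where
  carrier := {x | abs x < 1}
  add_mem' {x y} hx hy := (hna x y).trans_lt (max_lt hx hy)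
  zero_mem' := by
    simp only [mem_setOf_eq]
    rw [(hv.eq_zero_iff 0).2 rfl]; exact one_pos
  neg_mem' {x} hx := by
    simp only [mem_setOf_eq] at hx ⊢
    rwa [abs_neg_of_valued hv]

/-- `x ∈ 1 + 𝔪 ↔ x − 1 ∈ 𝔪`. [folklore] -/
theorem mem_oneUnits_iff_sub_mem_maxIdeal (hv : IsValuedField abs) (hna : IsNonarchimedeanAbs abs) (x : K) :
    x ∈ oneUnits hv hna ↔ x - 1 ∈ maxIdeal hv hna := Iff.rfl

variable (p : ℕ)

/-- **`(1 + 𝔪_{𝒪_K})~ ⊂ K̃`** (§3.2 p.17 l.13–16): the sequences of `K̃` all of whose entries are one-units — the intersection of the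
perfection with the product submonoid. [claim: Joshi2023ATS2half, status: disputed] -/
def tildeOneUnits (hv : IsValuedField abs) (hna : IsNonarchimedeanAbs abs) : Submonoid (ℕ → K) :=
  tildeMonoid K p ⊓ Submonoid.pi Set.univ fun _ => oneUnits hv hna

/-- Membership in `(1 + 𝔪)~`. [claim: Joshi2023ATS2half, status: disputed] -/
theorem mem_tildeOneUnits_iff (hv : IsValuedField abs) (hna : IsNonarchimedeanAbs abs) (f : ℕ → K) :
    f ∈ tildeOneUnits p hv hna ↔ (∀ n, f (n + 1) ^ p = f n) ∧ ∀ n, abs (f n - 1) < 1 := by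
  simp [tildeOneUnits, Submonoid.mem_inf, Submonoid.mem_pi, mem_tildeMonoid_iff, mem_oneUnits_iff]

end OneUnits

section LocalClaims

variable (K : Type u) [Field K] [TopologicalSpace K] (abs : K → ℝ) (p : ℕ)
variable (Kf : Type u) [Field Kf] [TopologicalSpace Kf] (absf : Kf → ℝ)

/-- **Lem. 3.1.4** (p.17 l.3–9; «a consequence of [Scholze, 2012, Lemma 3.4]»): «There is a continuous isomorphism of multiplicative
monoids K̃ ≃ K♭. In particular, the isomorphism class of the monoid K̃ is independent of perfectoid field K and depends only on K♭.»
Typed over an abstract tilt `K♭ = Kf` (a topological field, multiplicatively a monoid): an isomorphism of topological monoids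
`K̃ ≃ K♭`. (Mathlib has the RING-level tilt `PreTilt`/`Perfection` of `𝒪_K/p`, not this monoid comparison.) HYPOTHESIS (claim).
[claim: Joshi2023ATS2half, status: disputed] -/
@[claim "Joshi2023ATS2half" "disputed"]
def Lem314 : Prop :=
  Nonempty (tildeMonoid K p ≃ₜ* Kf)

/-- **Prop. 3.2.1** (p.17 l.18–19; [FF18, Ch. 4]): «The multiplicative monoid (1 + 𝔪_{𝒪_K})~ is topologically isomorphic to 1 + 𝔪_{𝒪_{K♭}}
and hence in particular, its topological isomorphism class depends only on K♭.» Over the valued-field data of `K` and of its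
tilt. HYPOTHESIS (claim). [claim: Joshi2023ATS2half, status: disputed] -/
@[claim "Joshi2023ATS2half" "disputed"]
def Prop321 (hv : IsValuedField abs) (hna : IsNonarchimedeanAbs abs) (hvf : IsValuedField absf)
    (hnaf : IsNonarchimedeanAbs absf) : Prop :=
  Nonempty (tildeOneUnits p hv hna ≃ₜ* oneUnits hvf hnaf)

/-- **§3.2, the logarithm** (p.17 l.20–25): «One has a continuous surjective homomorphism log : (1 + 𝔪_{𝒪_K})~ → K given by
(x_n)_{n∈ℤ} ↦ log(x_0), where log is the p-adic logarithm, and the kernel of this homomorphism is a one dimensional ℚ_p-vector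
space … even a surjection of Banach spaces [FF18, Prop. 4.5.14, Ex. 4.5.15].» Typed for a given `p`-adic logarithm `log` on the
one-units (a homomorphism to `(K, +)`): the composite with `(x_n) ↦ x_0` is continuous and surjective. The kernel clause is NOT
typed (it needs the `ℚ_p`-structure of the kernel). HYPOTHESIS (claim). [claim: Joshi2023ATS2half, status: disputed] -/
@[claim "Joshi2023ATS2half" "disputed"]
def LogSurjective (hv : IsValuedField abs) (hna : IsNonarchimedeanAbs abs) (log : oneUnits hv hna →* Multiplicative K) :
    Prop :=
  let log0 : tildeOneUnits p hv hna → K := fun f =>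
    Multiplicative.toAdd (log ⟨f.1 0, ((mem_tildeOneUnits_iff p hv hna f.1).1 f.2).2 0⟩)
  Continuous log0 ∧ Function.Surjective log0

end LocalClaims

/-! ## 3. Thm. 3.2.2, Cor. 3.3.1, Thm. 3.5.1 (claims over a family of untilts of a fixed tilt `F`) -/

section UntiltFamily

variable {Y : Type u} (KK : Y → Type u) [∀ y, Field (KK y)] [∀ y, TopologicalSpace (KK y)] (abs : ∀ y, KK y → ℝ)
  (F : Type u) [Field F] [TopologicalSpace F] (absF : F → ℝ) (p : ℕ)

/-- **Thm. 3.2.2 (1)** (p.17 l.36–38): for every characteristic-zero untilt `(K, K♭ ≃ ℂ_p♭)` of `F = ℂ_p♭`, «an isomorphism of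
topological multiplicative monoids K̃ ≃ ℂ_p♭» («[Scholze 2012, Lem. 3.4]», p.18 l.12–13), over a family of untilts `KK y` of the
fixed tilt `F`. HYPOTHESIS (claim). [claim: Joshi2023ATS2half, status: disputed] -/
@[claim "Joshi2023ATS2half" "disputed"]
def Thm322_1 : Prop :=
  ∀ y, Nonempty (tildeMonoid (KK y) p ≃ₜ* F)

/-- **Thm. 3.2.2 (2)** (p.17 l.39–44): «an isomorphism of topological multiplicative monoids (this is in fact an isomorphism of
ℚ_p-Banach spaces) (1 + 𝔪_{𝒪_K})~ ≃ 1 + 𝔪_{𝒪_{ℂ_p♭}}» — typed at the level of topological monoids (the Banach clause in prose).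
HYPOTHESIS (claim). [claim: Joshi2023ATS2half, status: disputed] -/
@[claim "Joshi2023ATS2half" "disputed"]
def Thm322_2 (hv : ∀ y, IsValuedField (abs y)) (hna : ∀ y, IsNonarchimedeanAbs (abs y)) (hvF : IsValuedField absF)
    (hnaF : IsNonarchimedeanAbs absF) : Prop :=
  ∀ y, Nonempty (tildeOneUnits p (hv y) (hna y) ≃ₜ* oneUnits hvF hnaF)

/-- **Thm. 3.2.2 (3)** (p.18 l.1–2): «In particular, K̃ and (1 + 𝔪_{𝒪_K})~ is independent of the choice of K (i.e. the multiplicative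
structure of K is independent of the choice of K)» — typed for `K̃`: any two untilts have isomorphic topological monoids `K̃`.
HYPOTHESIS (claim), DERIVED from (1) below. [claim: Joshi2023ATS2half, status: disputed] -/
@[claim "Joshi2023ATS2half" "disputed"]
def Thm322_3 : Prop :=
  ∀ y₁ y₂, Nonempty (tildeMonoid (KK y₁) p ≃ₜ* tildeMonoid (KK y₂) p)

/-- **Thm. 3.2.2 (4)** (p.18 l.3–9): «there exists untilts (K₁, K♭₁ ≃ ℂ_p♭), (K₂, K♭₂ ≃ ℂ_p♭) such that the topological fields K₁ and K₂
are not topologically isomorphic but one has an isomorphism of multiplicative structures K̃₁ ≃ K̃₂» (via [Kedlaya–Temkin 2018] and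
[Joshi 2019], p.18 l.15–19). HYPOTHESIS (claim). [claim: Joshi2023ATS2half, status: disputed] -/
@[claim "Joshi2023ATS2half" "disputed"]
def Thm322_4 : Prop :=
  ∃ y₁ y₂, (¬ ∃ e : KK y₁ ≃+* KK y₂, Continuous e ∧ Continuous e.symm) ∧
    Nonempty (tildeMonoid (KK y₁) p ≃* tildeMonoid (KK y₂) p)

/-- **Thm. 3.2.2 (3) DERIVED from (1)**: compose `K̃₁ ≃ F ≃ K̃₂` («The third follows from the fact that topological isomorphism
class of K̃ ≃ F is independent of K as F is independent of K», p.18 l.14–15). ((5), the Lubin–Tate variant «which shall be added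
later», is prose.) [claim: Joshi2023ATS2half, status: disputed] -/
theorem thm322_3_of_1 (h : Thm322_1 KK F p) : Thm322_3 KK p := fun y₁ y₂ =>
  let ⟨e₁⟩ := h y₁
  let ⟨e₂⟩ := h y₂
  ⟨e₁.trans e₂.symm⟩

/-- **Cor. 3.3.1** (p.18 l.24–27): «The Fargues–Fontaine curve Y_{ℂ_p♭,ℚ_p} provides a continuous family of algebraically closed
perfectoid fields whose multiplicative structure is fixed (in the above sense) while the topological structure of the fields
vary.» PARAPHRASE (honest): typed as the conjunction of Thm. 3.2.2 (3) («multiplicative structure fixed») and (4) («topological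
structure varies»); «continuous family» is not typed. [claim: Joshi2023ATS2half, status: disputed] -/
@[claim "Joshi2023ATS2half" "disputed"]
def Cor331 : Prop :=
  Thm322_3 KK p ∧ Thm322_4 KK p

/-- Cor. 3.3.1 from Thm. 3.2.2 (1) and (4) («an important and immediate consequence», p.18 l.20–21). [claim: Joshi2023ATS2half,
status: disputed] -/
theorem cor331_of (h1 : Thm322_1 KK F p) (h4 : Thm322_4 KK p) : Cor331 KK p :=
  ⟨thm322_3_of_1 KK F p h1, h4⟩

/-- **Thm. 3.5.1** (p.19 l.27–49): «Let F be an algebraically closed perfectoid field of characteristic p > 0 … Then one has an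
isomorphism of the ℤ_p-modules (𝔪_F, +) →^{AH} (1 + 𝔪_F, ×), where AH is the Artin–Hasse exponential … Especially one has an
additive and a multiplicative (but equivalent) descriptions of closed classical points on Y_{F,ℚ_p}: ((𝔪_F,+) − {0})/ℤ_p^* ≃
|Y_{F,ℚ_p}| ≃ ((1 + 𝔪_F, ×) − {1})/ℤ_p^*» ([FF18, 2.3.10, 2.3.11, 4.4.7]). Typed at group level: a bijection `𝔪_F ≃ 1 + 𝔪_F` turning
`+` into `×` (the Artin–Hasse series and the `ℤ_p`-linearity are not in Mathlib; the two quotient descriptions, which need the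
Lubin–Tate `ℤ_p^*`-action, are NOT typed). HYPOTHESIS (claim). [claim: Joshi2023ATS2half, status: disputed] -/
@[claim "Joshi2023ATS2half" "disputed"]
def Thm351 (hvF : IsValuedField absF) (hnaF : IsNonarchimedeanAbs absF) : Prop :=
  ∃ e : maxIdeal hvF hnaF ≃ oneUnits hvF hnaF, ∀ a b, (e (a + b) : F) = e a * e b

end UntiltFamily


end Summit.ABC.IUTFork.Joshi.ATS2half

end
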